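import Summits.Ventures.Crystal3D.Theorems.StickyWulffConstantCoaxialWallLawModelNormals
import Summits.Ventures.Crystal3D.Theorems.StickyWulffConstantGenericWallFloorTwinFrame
import HarnessLib

/-!
# The word classes of the co-axial cell: frames, model directions and letters (push / pop)

HONEST FRAMING. Part of the venture `Summits/Ventures/Crystal3D` (cell `crystal3d-full`), helper for the
crux `CoaxialWallLaw` (stmt-Ventures-19481) of `route-Ventures-StickyWulffConstant`, REGISTERED line
`WallLedgerF` (planner cf-p1 gen 16), open stub `stub_coaxialTwoSlabAdhesion` (general fillings).  Brick W6 of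
the v2 (NET) line automaton (memo F-NET-AUTOMATON-v2 §7, evidence on the crux item).  Rung credit only; F-C1 not
moved.

CLASSES ARE WORDS.  A class of the word automaton is a list `κ = [μ₁, …, μ_k]` of MODEL `{111}` normals (most
recent first) over the bottom frame `G₀`; its frame is `F κ = G₀ ∘ R_{μ_k} ∘ ⋯ ∘ R_{μ₁}` (`R_μ` the mirror across
`μ^⊥`, so `F (μ :: κ) = F κ ∘ R_μ`), its model direction slot is `u κ = (−1)^k u₀`, and its direction is
`d κ = F κ (u κ)`.  A word is WELL FORMED (`WF`) when every letter `μ` pushed onto `κ'` is a unit model menu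
normal with `⟪u κ', μ⟫ = +√(2/3)` and is not the opposite of the head of `κ'`.  This file characterises these
objects by EQUATIONS (hypotheses `hF0/hFc/hu0/huc/hWF0/hWFc`, so that the assembly can instantiate them by
`List.foldr` without new definitions) and proves the letter calculus used to discharge the abstract hypotheses
of `…WordMoves` / `…WordStep` / `…WordCore`:

* `word_u_mem` (`u κ` is a slot), `word_F_cons_apply` (`F (μ::κ) x = F κ (x − 2⟪x,μ⟫ μ)`);
* for a CROSSING NORMAL `m` of `κ` (unit, menu for `F κ`, `⟪d κ, m⟫ = +√(2/3)`) with model letter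
  `ν = (F κ)⁻¹ m`: `word_letter_props` (ν is a unit model menu normal with `⟪u κ, ν⟫ = √(2/3)` and `F κ ν = m`);
  PUSH (`word_push_frame`, `word_push_dir`, `word_push_wf`, `word_push_letter`): `F (ν::κ) = R_m ∘ F κ`,
  `⟪d (ν::κ), m⟫ = √(2/3)`, `WF (ν::κ)` unless `κ = μ :: κ'` with `ν = −μ`, and `(F (ν::κ))⁻¹ m = −ν`;
  POP (`word_pop_frame`, `word_pop_dir`, `word_pop_letter`): for `κ = μ :: κ'` with `ν = −μ`:
  `F κ' = R_m ∘ F κ`, `⟪d κ', m⟫ = √(2/3)`, `(F κ')⁻¹ m = μ` (and `WF` forbids `head κ' = −μ`).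

WHAT THIS IS NOT: not the stub; F-C1 not moved.
-/

noncomputable section

namespace Summit.Ventures.Crystal3D.Theorems

open Summit.Ventures.Crystal3D Finset
open Literature.MathematicalPhysics.StatisticalMechanics (fccStacking)
open scoped InnerProductSpace

section Letters

variable {G₀ : EuclideanSpace ℝ (Fin 3) ≃ₗᵢ[ℝ] EuclideanSpace ℝ (Fin 3)} {u₀ : EuclideanSpace ℝ (Fin 3)}
  {F : List (EuclideanSpace ℝ (Fin 3)) → (EuclideanSpace ℝ (Fin 3) ≃ₗᵢ[ℝ] EuclideanSpace ℝ (Fin 3))}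
  {u : List (EuclideanSpace ℝ (Fin 3)) → EuclideanSpace ℝ (Fin 3)}
  {WF : List (EuclideanSpace ℝ (Fin 3)) → Prop}

/-- The model direction slot of every word is a slot. -/
theorem word_u_mem (hu₀ : u₀ ∈ fccSlots) (hu0 : u [] = u₀) (huc : ∀ μ κ, u (μ :: κ) = -u κ) :
    ∀ κ, u κ ∈ fccSlots := by
  intro κ
  induction κ with
  | nil => rw [hu0]; exact hu₀
  | cons μ κ ih => rw [huc]; exact neg_mem_fccSlots ih

/-- Pointwise form of the frame recursion: `F (μ :: κ) x = F κ (x − 2⟪x, μ⟫ μ)` for a unit letter. -/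
theorem word_F_cons_apply
    (hFc : ∀ μ κ, F (μ :: κ) = ((ℝ ∙ μ)ᗮ.reflection).trans (F κ))
    {μ : EuclideanSpace ℝ (Fin 3)} (hμ : ‖μ‖ = 1) (κ : List (EuclideanSpace ℝ (Fin 3))) (x : EuclideanSpace ℝ (Fin 3)) :
    F (μ :: κ) x = F κ (x - (2 * ⟪x, μ⟫_ℝ) • μ) := by
  rw [hFc, LinearIsometryEquiv.trans_apply, reflection_unit_apply hμ]

/-- Conjugation: `R_{G μ} (G x) = G (R_μ x)`. -/
theorem mirror_conj (G : EuclideanSpace ℝ (Fin 3) ≃ₗᵢ[ℝ] EuclideanSpace ℝ (Fin 3)) (μ x : EuclideanSpace ℝ (Fin 3)) :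
    G x - (2 * ⟪G x, G μ⟫_ℝ) • G μ = G (x - (2 * ⟪x, μ⟫_ℝ) • μ) := by
  rw [LinearIsometryEquiv.inner_map_map, map_sub, LinearIsometryEquiv.map_smul]

/-- **The model letter of a crossing normal.**  For a crossing normal `m` of `κ` the letter `ν = (F κ)⁻¹ m` is a
unit model menu normal with `⟪u κ, ν⟫ = √(2/3)` and `F κ ν = m`. -/
theorem word_letter_props (κ : List (EuclideanSpace ℝ (Fin 3))) {m : EuclideanSpace ℝ (Fin 3)} (hm : ‖m‖ = 1)
    (hmenu : ∀ w ∈ fccSlots, ⟪F κ w, m⟫_ℝ = 0 ∨ ⟪F κ w, m⟫_ℝ = Real.sqrt (2 / 3) ∨ ⟪F κ w, m⟫_ℝ = -Real.sqrt (2 / 3))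
    (hdm : ⟪F κ (u κ), m⟫_ℝ = Real.sqrt (2 / 3)) :
    ‖(F κ).symm m‖ = 1 ∧
    (∀ w ∈ fccSlots, ⟪w, (F κ).symm m⟫_ℝ = 0 ∨ ⟪w, (F κ).symm m⟫_ℝ = Real.sqrt (2 / 3) ∨
      ⟪w, (F κ).symm m⟫_ℝ = -Real.sqrt (2 / 3)) ∧
    ⟪u κ, (F κ).symm m⟫_ℝ = Real.sqrt (2 / 3) ∧ F κ ((F κ).symm m) = m := by
  have key : ∀ w, ⟪w, (F κ).symm m⟫_ℝ = ⟪F κ w, m⟫_ℝ := by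
    intro w
    rw [← LinearIsometryEquiv.inner_map_map (F κ) w ((F κ).symm m), LinearIsometryEquiv.apply_symm_apply]
  refine ⟨by rw [LinearIsometryEquiv.norm_map, hm], fun w hw => by rw [key]; exact hmenu w hw,
    by rw [key]; exact hdm, LinearIsometryEquiv.apply_symm_apply _ _⟩

/-- **PUSH, frame**: `F (ν :: κ) x = F κ x − 2⟪F κ x, m⟫ m` for the letter `ν = (F κ)⁻¹ m`. -/
theorem word_push_frame (hFc : ∀ μ κ, F (μ :: κ) = ((ℝ ∙ μ)ᗮ.reflection).trans (F κ))
    (κ : List (EuclideanSpace ℝ (Fin 3))) {m : EuclideanSpace ℝ (Fin 3)} (hm : ‖m‖ = 1) (x : EuclideanSpace ℝ (Fin 3)) :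
    F ((F κ).symm m :: κ) x = F κ x - (2 * ⟪F κ x, m⟫_ℝ) • m := by
  have hν : ‖(F κ).symm m‖ = 1 := by rw [LinearIsometryEquiv.norm_map, hm]
  rw [word_F_cons_apply hFc hν, ← mirror_conj, LinearIsometryEquiv.apply_symm_apply]

/-- **PUSH, direction**: `⟪d (ν :: κ), m⟫ = √(2/3)`. -/
theorem word_push_dir (hFc : ∀ μ κ, F (μ :: κ) = ((ℝ ∙ μ)ᗮ.reflection).trans (F κ))
    (huc : ∀ μ κ, u (μ :: κ) = -u κ)
    (κ : List (EuclideanSpace ℝ (Fin 3))) {m : EuclideanSpace ℝ (Fin 3)} (hm : ‖m‖ = 1)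
    (hdm : ⟪F κ (u κ), m⟫_ℝ = Real.sqrt (2 / 3)) :
    ⟪F ((F κ).symm m :: κ) (u ((F κ).symm m :: κ)), m⟫_ℝ = Real.sqrt (2 / 3) := by
  rw [huc, word_push_frame hFc κ hm, map_neg]
  simp only [inner_sub_left, inner_neg_left, real_inner_smul_left, real_inner_self_eq_norm_sq, hm, hdm]
  ring

/-- **PUSH, the new frame reads `m` as the letter `−ν`**: `(F (ν :: κ))⁻¹ m = −ν`. -/
theorem word_push_letter (hFc : ∀ μ κ, F (μ :: κ) = ((ℝ ∙ μ)ᗮ.reflection).trans (F κ))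
    (κ : List (EuclideanSpace ℝ (Fin 3))) {m : EuclideanSpace ℝ (Fin 3)} (hm : ‖m‖ = 1) :
    (F ((F κ).symm m :: κ)).symm m = -(F κ).symm m := by
  have hν : ‖(F κ).symm m‖ = 1 := by rw [LinearIsometryEquiv.norm_map, hm]
  apply (F ((F κ).symm m :: κ)).injective
  rw [LinearIsometryEquiv.apply_symm_apply, word_F_cons_apply hFc hν, inner_neg_left,
    real_inner_self_eq_norm_sq, hν]
  have : -(F κ).symm m - (2 * -((1 : ℝ) ^ 2)) • (F κ).symm m = (F κ).symm m := by module
  rw [this, LinearIsometryEquiv.apply_symm_apply]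

/-- **PUSH, well-formedness**: the pushed word is well formed unless the letter pops. -/
theorem word_push_wf
    (hWFc : ∀ μ κ, WF (μ :: κ) ↔ (WF κ ∧ ‖μ‖ = 1 ∧
      (∀ w ∈ fccSlots, ⟪w, μ⟫_ℝ = 0 ∨ ⟪w, μ⟫_ℝ = Real.sqrt (2 / 3) ∨ ⟪w, μ⟫_ℝ = -Real.sqrt (2 / 3)) ∧
      ⟪u κ, μ⟫_ℝ = Real.sqrt (2 / 3) ∧ ∀ μ' κ', κ = μ' :: κ' → μ' ≠ -μ))
    {κ : List (EuclideanSpace ℝ (Fin 3))} (hκ : WF κ) {m : EuclideanSpace ℝ (Fin 3)} (hm : ‖m‖ = 1)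
    (hmenu : ∀ w ∈ fccSlots, ⟪F κ w, m⟫_ℝ = 0 ∨ ⟪F κ w, m⟫_ℝ = Real.sqrt (2 / 3) ∨ ⟪F κ w, m⟫_ℝ = -Real.sqrt (2 / 3))
    (hdm : ⟪F κ (u κ), m⟫_ℝ = Real.sqrt (2 / 3))
    (hnopop : ∀ μ' κ', κ = μ' :: κ' → (F κ).symm m ≠ -μ') :
    WF ((F κ).symm m :: κ) := by
  obtain ⟨hν, hνmenu, hνu, -⟩ := word_letter_props κ hm hmenu hdm
  rw [hWFc]
  refine ⟨hκ, hν, hνmenu, hνu, fun μ' κ' h hμ' => hnopop μ' κ' h ?_⟩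
  rw [hμ', neg_neg]

/-- **POP, frame**: for `κ = μ :: κ'` read through `ν = (F κ)⁻¹ m = −μ`: `F κ' x = F κ x − 2⟪F κ x, m⟫ m`. -/
theorem word_pop_frame (hFc : ∀ μ κ, F (μ :: κ) = ((ℝ ∙ μ)ᗮ.reflection).trans (F κ))
    (μ : EuclideanSpace ℝ (Fin 3)) (κ' : List (EuclideanSpace ℝ (Fin 3))) (hμ : ‖μ‖ = 1)
    {m : EuclideanSpace ℝ (Fin 3)} (hν : (F (μ :: κ')).symm m = -μ) (x : EuclideanSpace ℝ (Fin 3)) :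
    F κ' x = F (μ :: κ') x - (2 * ⟪F (μ :: κ') x, m⟫_ℝ) • m := by
  -- `m = F κ (−μ) = F κ' μ`
  have hm' : m = F κ' μ := by
    have h1 : F (μ :: κ') (-μ) = m := by rw [← hν, LinearIsometryEquiv.apply_symm_apply]
    rw [← h1, word_F_cons_apply hFc hμ, inner_neg_left, real_inner_self_eq_norm_sq, hμ]
    congr 1; module
  rw [hm', word_F_cons_apply hFc hμ, mirror_conj]
  congr 1
  rw [inner_sub_left, real_inner_smul_left, real_inner_self_eq_norm_sq, hμ]
  module

/-- **POP, the letter**: `(F κ')⁻¹ m = μ`. -/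
theorem word_pop_letter (hFc : ∀ μ κ, F (μ :: κ) = ((ℝ ∙ μ)ᗮ.reflection).trans (F κ))
    (μ : EuclideanSpace ℝ (Fin 3)) (κ' : List (EuclideanSpace ℝ (Fin 3))) (hμ : ‖μ‖ = 1)
    {m : EuclideanSpace ℝ (Fin 3)} (hν : (F (μ :: κ')).symm m = -μ) : (F κ').symm m = μ := by
  apply (F κ').injective
  rw [LinearIsometryEquiv.apply_symm_apply]
  have h1 : F (μ :: κ') (-μ) = m := by rw [← hν, LinearIsometryEquiv.apply_symm_apply]
  rw [← h1, word_F_cons_apply hFc hμ, inner_neg_left, real_inner_self_eq_norm_sq, hμ]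
  congr 1; module

/-- **POP, direction**: `⟪d κ', m⟫ = √(2/3)` (the letter `μ` was pushed with `⟪u κ', μ⟫ = √(2/3)`). -/
theorem word_pop_dir (hFc : ∀ μ κ, F (μ :: κ) = ((ℝ ∙ μ)ᗮ.reflection).trans (F κ))
    (hWFc : ∀ μ κ, WF (μ :: κ) ↔ (WF κ ∧ ‖μ‖ = 1 ∧
      (∀ w ∈ fccSlots, ⟪w, μ⟫_ℝ = 0 ∨ ⟪w, μ⟫_ℝ = Real.sqrt (2 / 3) ∨ ⟪w, μ⟫_ℝ = -Real.sqrt (2 / 3)) ∧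
      ⟪u κ, μ⟫_ℝ = Real.sqrt (2 / 3) ∧ ∀ μ' κ', κ = μ' :: κ' → μ' ≠ -μ))
    {μ : EuclideanSpace ℝ (Fin 3)} {κ' : List (EuclideanSpace ℝ (Fin 3))} (hκ : WF (μ :: κ'))
    {m : EuclideanSpace ℝ (Fin 3)} (hν : (F (μ :: κ')).symm m = -μ) :
    ⟪F κ' (u κ'), m⟫_ℝ = Real.sqrt (2 / 3) := by
  obtain ⟨-, hμ, -, hμu, -⟩ := (hWFc μ κ').1 hκ
  have hm' : m = F κ' μ := by
    rw [← word_pop_letter hFc μ κ' hμ hν, LinearIsometryEquiv.apply_symm_apply]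
  rw [hm', LinearIsometryEquiv.inner_map_map, hμu]

/-- **PUSH then POP**: after pushing `ν`, the same normal reads as `−ν`, so it pops back to `κ`; and
**POP then PUSH**: after popping `μ` from `μ :: κ'`, the same normal reads as `μ` and well-formedness forbids
`head κ' = −μ`, so it pushes back. -/
theorem word_pop_head_ne
    (hWFc : ∀ μ κ, WF (μ :: κ) ↔ (WF κ ∧ ‖μ‖ = 1 ∧
      (∀ w ∈ fccSlots, ⟪w, μ⟫_ℝ = 0 ∨ ⟪w, μ⟫_ℝ = Real.sqrt (2 / 3) ∨ ⟪w, μ⟫_ℝ = -Real.sqrt (2 / 3)) ∧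
      ⟪u κ, μ⟫_ℝ = Real.sqrt (2 / 3) ∧ ∀ μ' κ', κ = μ' :: κ' → μ' ≠ -μ))
    {μ : EuclideanSpace ℝ (Fin 3)} {κ' : List (EuclideanSpace ℝ (Fin 3))} (hκ : WF (μ :: κ')) :
    ∀ μ' κ'', κ' = μ' :: κ'' → μ' ≠ -μ :=
  ((hWFc μ κ').1 hκ).2.2.2.2

end Letters

end Summit.Ventures.Crystal3D.Theorems

end
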